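import Mathlib
import HarnessLib
import Summits.ValiantsHypothesis.ValiantsHypothesis.Theses.MonotoneRestoration
import Literature.Computability.AlgebraicComplexity.ArithCircuit
import Literature.Computability.AlgebraicComplexity.ArithCircuitProofs
import Literature.Computability.AlgebraicComplexity.MonotoneStructure
import Literature.Computability.AlgebraicComplexity.PermanentIrreducible
import Literature.ModelTheory.FiniteModelTheory.CkEquiv
import Summits.ValiantsHypothesis.ValiantsHypothesis.Theorems.MonotoneRestorationMonotoneRestorationQPCosetCount
import Summits.ValiantsHypothesis.ValiantsHypothesis.Theorems.MonotoneRestorationMonotoneRestorationQPSymmetricLB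
import Summits.ValiantsHypothesis.ValiantsHypothesis.Theorems.MonotoneRestorationMonotoneRestorationQPSupportSymmetrisation
import Summits.ValiantsHypothesis.ValiantsHypothesis.Theorems.MonotoneRestorationMonotoneRestorationQPSparseRegime
import Summits.ValiantsHypothesis.ValiantsHypothesis.Theorems.MonotoneRestorationMonotoneRestorationQPBeta
import Literature.Computability.AlgebraicComplexity.SymmetricArithCircuit
import Literature.Computability.AlgebraicComplexity.DawarWilsenach2025Proofs
import Literature.GroupTheory.PermutationGroups.SmallIndexSubgroups
import Summits.ValiantsHypothesis.ValiantsHypothesis.Theorems.MonotoneRestorationQP.Negative.LoadBearing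
import Summits.ValiantsHypothesis.ValiantsHypothesis.Theorems.MonotoneRestorationMonotoneRestorationQPPermSupportCount

/-! # TTRL-lite variant V18998 of `MonotoneRestorationQP` / `stub_altFixing_orbit_dichotomy` (stmt-ValiantsHypothesis-15886)

Machine-generated helper (proved); move `lemma_proposal`, op `llm`: SIZE OF Ω: |{x ∉ X}| = n - |X| (`Fintype.card_subtype_compl`, `card_coe`, `card_fin`) — converts h8/hT into 5 ≤ |Ω| and |T| < |Ω|; trivial anchor for the map.
See docs/architecture/ttrl-lite.md. -/

namespace Summit.ValiantsHypothesis.ValiantsHypothesis.Theorems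

open Summit.ValiantsHypothesis.ValiantsHypothesis.Theses.MonotoneRestoration
open Literature.Computability.AlgebraicComplexity

/-- TTRL-lite variant V18998 (lemma_proposal `llm`) of `stub_altFixing_orbit_dichotomy` (stmt-ValiantsHypothesis-15886); machine-found, kernel-checked. -/
theorem stub_altFixing_orbit_dichotomy_var18998 :
    ∀ (n : ℕ) (X : Finset (Fin n)), Fintype.card {x : Fin n // x ∉ X} = n - X.card := by
  intros
  norm_num

end Summit.ValiantsHypothesis.ValiantsHypothesis.Theorems
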